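import Summits.AtomisticToContinuum.FouriersLaw.Theorems.VanishingNoiseTransferNoiseLocalityMonotoneReduction
import Summits.AtomisticToContinuum.FouriersLaw.Theorems.VanishingNoiseTransferNoiseLocalityStubFlipDissipationBound

/-!
# `NoiseLocality` (stmt-AtomisticToContinuum-11975) reduced to ORDER IN THE NOISE + pointwise no-residual-resistivity + a fixed-rate
# noisy floor (Pólya reduction; line `polya-noise-monotone`)

`--supports stmt-AtomisticToContinuum-11975` record of the ALTERNATIVE line `polya-noise-monotone` (crux-strategist
`planner-cstrat-stmt-AtomisticToContinuum-11975-s2-0`, 2026-08-17; tree copy `Cruxes/NoiseLocality/Lines/polya_noise_monotone.lean`).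
The Pólya dual of the tail-monotone reduction (`…TailMonotoneReduction`, v7): the `N`-uniform modulus of the crux is manufactured from
ORDER IN THE RATE at fixed length (no two lengths are ever compared) plus POINTWISE-in-the-rate closeness, instead of order in the
length plus a fixed-length sign.

* `scaling_of_master`, `noise_scaling` — FREE structure at positive rates: for every `N` and `0 < ε ≤ ε' ≤ 1`, along the unique
  flip-steady families, `ε·D_N(ε) ≤ ε'·D_N(ε')`; the landed two-rate master inequality `|D − D'| ≤ |ε − ε'|√(D/ε)√(D'/ε')`
  (`helper_duhamelFlipBoundTwoRates` + `stub_flipDissipationBound` + `le_of_two_rate_bounds`) solves exactly to `ε/ε' ≤ D'/D ≤ ε'/ε`.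
* `closure_le`, `modulus_of_polya` — pure real analysis (Pólya-type transfer): `r N` continuous and nonnegative on `[0,1]` with the
  scaling `r N ε' ≤ (ε'/ε) r N ε`; (S1) upward equi-quasi-monotonicity in `ε` on a tail of lengths for small rates; (S2) for each small
  rate, eventual-in-`N` closeness `r N ε ≤ r N 0 + η`; (F) an eventual bound on `r N ε` at each fixed rate; then ONE modulus
  `w ε := sup_N |r N ε − r N 0| → 0` at `0⁺`.
* `noiseLocality_of_polya` — **(S1) → (S2) → (F) → NoiseLocality**, the registered texts of `stub_smallNoiseQuasiMonotone`,
  `stub_noResidualResistivity`, `stub_noisyConductanceFloor` verbatim as hypotheses (canonical responses from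
  `MonotoneReduction.canonical_of_three`, i.e. the landed stubs 1–3). CONDITIONAL (S1, S2 open; F follows from the open crux
  `NoisyFourier`, `noisyFloor_of_noisyFourier`); nothing here closes the item.
* `noiseLocality_of_polya_noisyFourier` — the same within the route's cone: (S1) → (S2) → `NoisyFourier` → `NoiseLocality`.
* `helper_noiseLocalityOfPolya` — registry form.

Each hypothesis is NECESSARY for the crux (S1, S2) or for the route (F ⊂ `NoisyFourier`); none alone gives the crux (tables in
`Cruxes/NoiseLocality/Lines/polya_noise_monotone_tables.lean`). No `sorry`, no definitions, no named facts; axioms `propext`,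
`Classical.choice`, `Quot.sound`.
-/

noncomputable section

namespace Summit.AtomisticToContinuum.FouriersLaw.Theorems.NoiseLocality.PolyaReduction

open Filter Topology MeasureTheory
open Literature.MathematicalPhysics.KineticTheory.HeatConduction

/-! ## Free structure: the noise scaling -/

/-- Algebra of the exact solution of the two-rate master inequality: for `0 < ε ≤ ε'`, `D, D' ≥ 0` with
`|D − D'| ≤ |ε − ε'| √(D/ε) √(D'/ε')` one has `ε D ≤ ε' D'` (substitute `D = ε s²`, `D' = ε' t²`: the hypothesis
reads `(s + t)(ε s − ε' t) ≤ 0`). [folklore] -/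
theorem scaling_of_master {ε ε' D D' : ℝ} (hε : 0 < ε) (hεε' : ε ≤ ε') (hD : 0 ≤ D) (hD' : 0 ≤ D')
    (h : |D - D'| ≤ |ε - ε'| * Real.sqrt (D / ε) * Real.sqrt (D' / ε')) : ε * D ≤ ε' * D' := by
  have hε' : 0 < ε' := hε.trans_le hεε'
  have hεne : ε ≠ 0 := hε.ne'
  have hε'ne : ε' ≠ 0 := hε'.ne'
  set s : ℝ := Real.sqrt (D / ε) with hs
  set t : ℝ := Real.sqrt (D' / ε') with ht
  have hs0 : 0 ≤ s := Real.sqrt_nonneg _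
  have ht0 : 0 ≤ t := Real.sqrt_nonneg _
  have hs2 : s ^ 2 = D / ε := Real.sq_sqrt (div_nonneg hD hε.le)
  have ht2 : t ^ 2 = D' / ε' := Real.sq_sqrt (div_nonneg hD' hε'.le)
  have hDs : D = ε * s ^ 2 := by rw [hs2]; field_simp
  have hDt : D' = ε' * t ^ 2 := by rw [ht2]; field_simp
  have habs : |ε - ε'| = ε' - ε := by
    rw [abs_sub_comm]
    exact abs_of_nonneg (by linarith)
  rw [habs] at h
  rw [hDs, hDt] at h ⊢
  by_contra hlt
  push Not at hlt
  -- `ε' t < ε s`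
  have h2 : ε' * t < ε * s := by
    by_contra hle
    push Not at hle
    have := mul_self_le_mul_self (by positivity : 0 ≤ ε * s) hle
    nlinarith
  have hs_pos : 0 < s := by
    have h' : 0 < ε * s := lt_of_le_of_lt (by positivity) h2
    exact (mul_pos_iff_of_pos_left hε).mp h'
  have h3 : 0 < s + t := by linarith
  have h4 : ε * s ^ 2 - ε' * t ^ 2 ≤ |ε * s ^ 2 - ε' * t ^ 2| := le_abs_self _
  nlinarith [mul_pos h3 (sub_pos.2 h2), h, h4]

/-- **Noise scaling (free, fixed `N`).** For the pinned anharmonic chain (all parameters `> 0`), `T > 0`, any `N`,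
rates `0 < ε ≤ ε' ≤ 1`, the unique flip-steady families at the two rates and their response coefficients:
`ε·D_N(ε) ≤ ε'·D_N(ε')`.  From the landed two-rate Duhamel bound in the flip Dirichlet form
(`helper_duhamelFlipBoundTwoRates`), the dissipation bound (`stub_flipDissipationBound`), the response densities
(`stub_responseDensityNoisy`), positivity (`stub_positiveNoisyConductance`) and `scaling_of_master`. [folklore] -/
theorem noise_scaling {ω₂ lam β γ : ℝ} (hω : 0 < ω₂) (hl : 0 < lam) (hβ : 0 < β) (hγ : 0 < γ) {T : ℝ}
    (hT : 0 < T) (N : ℕ) {ε ε' : ℝ} (hε : 0 < ε) (hεε' : ε ≤ ε') (hε'1 : ε' ≤ 1)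
    (με με' : ℝ → ℝ → Measure (PhaseSpace N))
    (hμε : ∀ T_L T_R : ℝ, 0 < T_L → 0 < T_R →
      (pinnedChain ω₂ lam β γ).IsFlipSteadyState N T_L T_R ε (με T_L T_R) ∧
        ∀ ν : Measure (PhaseSpace N), (pinnedChain ω₂ lam β γ).IsFlipSteadyState N T_L T_R ε ν → ν = με T_L T_R)
    (hμε' : ∀ T_L T_R : ℝ, 0 < T_L → 0 < T_R →
      (pinnedChain ω₂ lam β γ).IsFlipSteadyState N T_L T_R ε' (με' T_L T_R) ∧
        ∀ ν : Measure (PhaseSpace N), (pinnedChain ω₂ lam β γ).IsFlipSteadyState N T_L T_R ε' ν → ν = με' T_L T_R)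
    {Dε Dε' : ℝ}
    (hDε : Tendsto (fun δ : ℝ => (pinnedChain ω₂ lam β γ).totalCurrent (με (T + δ / 2) (T - δ / 2)) / δ)
      (𝓝[≠] 0) (𝓝 Dε))
    (hDε' : Tendsto (fun δ : ℝ => (pinnedChain ω₂ lam β γ).totalCurrent (με' (T + δ / 2) (T - δ / 2)) / δ)
      (𝓝[≠] 0) (𝓝 Dε')) :
    ε * Dε ≤ ε' * Dε' := by
  have hε' : 0 < ε' := hε.trans_le hεε'
  rcases Nat.lt_or_ge N 2 with hN | hN
  · have hN1 : N ≤ 1 := by omega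
    have h0 : Dε = 0 :=
      Summit.AtomisticToContinuum.FouriersLaw.Theorems.NoiseLocality.FeketeReduction.response_eq_zero_of_le_one
        _ hN1 με T Dε hDε
    have h0' : Dε' = 0 :=
      Summit.AtomisticToContinuum.FouriersLaw.Theorems.NoiseLocality.FeketeReduction.response_eq_zero_of_le_one
        _ hN1 με' T Dε' hDε'
    simp [h0, h0']
  obtain ⟨Uε, hUε⟩ :=
    Summit.AtomisticToContinuum.FouriersLaw.Theorems.NoiseLocality.stub_responseDensityNoisy
      ω₂ lam β γ hω hl hβ hγ T hT N ε hε με hμε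
  obtain ⟨Uε', hUε'⟩ :=
    Summit.AtomisticToContinuum.FouriersLaw.Theorems.NoiseLocality.stub_responseDensityNoisy
      ω₂ lam β γ hω hl hβ hγ T hT N ε' hε' με' hμε'
  have h1 :=
    Summit.AtomisticToContinuum.FouriersLaw.Theorems.NoiseLocality.helper_duhamelFlipBoundTwoRates
      ω₂ lam β γ hω hl hβ hγ T hT N ε ε' με με' hμε hμε' Uε Uε' hUε hUε' Dε Dε' hDε hDε'
  have h2 :=
    Summit.AtomisticToContinuum.FouriersLaw.Theorems.NoiseLocality.stub_flipDissipationBound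
      ω₂ lam β γ hω hl hβ hγ T hT N ε hε με hμε Uε hUε Dε hDε
  have h3 :=
    Summit.AtomisticToContinuum.FouriersLaw.Theorems.NoiseLocality.stub_flipDissipationBound
      ω₂ lam β γ hω hl hβ hγ T hT N ε' hε' με' hμε' Uε' hUε' Dε' hDε'
  have hn : 0 ≤ (N : ℝ) - 1 := by
    have : (2 : ℝ) ≤ N := by exact_mod_cast hN
    linarith
  have hm :=
    Summit.AtomisticToContinuum.FouriersLaw.Theorems.NoiseLocality.StubResponseContinuousInNoise.le_of_two_rate_bounds
      hε hε' hn h1 h2 h3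
  have hpos : 0 < Dε :=
    Summit.AtomisticToContinuum.FouriersLaw.Theorems.NoiseLocality.stub_positiveNoisyConductance
      ω₂ lam β γ hω hl hβ hγ N hN ε hε.le (hεε'.trans hε'1) T hT με hμε Dε hDε
  have hpos' : 0 < Dε' :=
    Summit.AtomisticToContinuum.FouriersLaw.Theorems.NoiseLocality.stub_positiveNoisyConductance
      ω₂ lam β γ hω hl hβ hγ N hN ε' hε'.le hε'1 T hT με' hμε' Dε' hDε'
  exact scaling_of_master hε hεε' hpos.le hpos'.le hm


/-! ## The edge F ⊂ NoisyFourier -/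

/-- **`NoisyFourier` ⟹ (F).**  Clause (i) gives a global unique flip-steady family at rate `ε`, clause (ii) a limit `κ_ε(T) > 0`
of its responses; so the responses are eventually `≥ κ_ε(T)/2`, and any unique family at one length has the same response (families
agree at positive temperatures; uniqueness of limits). [folklore] -/
theorem noisyFloor_of_noisyFourier
    (hNF : Summit.AtomisticToContinuum.FouriersLaw.Theses.VanishingNoiseTransfer.NoisyFourier) :
    ∀ ω₂ lam β γ : ℝ, 0 < ω₂ → 0 < lam → 0 < β → 0 < γ → ∀ T : ℝ, 0 < T →
    ∀ ε : ℝ, 0 < ε → ε ≤ 1 → ∃ d : ℝ, 0 < d ∧ ∃ N₀ : ℕ, ∀ (N : ℕ), N₀ ≤ N →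
    ∀ με : ℝ → ℝ →
        MeasureTheory.Measure (Literature.MathematicalPhysics.KineticTheory.HeatConduction.PhaseSpace N),
      (∀ T_L T_R : ℝ, 0 < T_L → 0 < T_R →
        (Literature.MathematicalPhysics.KineticTheory.HeatConduction.pinnedChain ω₂ lam β γ).IsFlipSteadyState
            N T_L T_R ε (με T_L T_R) ∧
          ∀ ν : MeasureTheory.Measure (Literature.MathematicalPhysics.KineticTheory.HeatConduction.PhaseSpace N),
            (Literature.MathematicalPhysics.KineticTheory.HeatConduction.pinnedChain ω₂ lam β γ).IsFlipSteadyState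
              N T_L T_R ε ν → ν = με T_L T_R) →
    ∀ Dε : ℝ,
      Filter.Tendsto (fun δ : ℝ =>
          (Literature.MathematicalPhysics.KineticTheory.HeatConduction.pinnedChain ω₂ lam β γ).totalCurrent
            (με (T + δ / 2) (T - δ / 2)) / δ) (nhdsWithin 0 {(0 : ℝ)}ᶜ) (nhds Dε) →
      d ≤ Dε := by
  intro ω₂ lam β γ hω hl hβ hγ T hT ε hε _hε1
  obtain ⟨hexu, κ, hκ, hconv⟩ := hNF ω₂ lam β γ hω hl hβ hγ _ rfl ε hε
  classical
  -- a global canonical family at rate `ε` (junk outside positive temperatures)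
  have hex : ∀ (N : ℕ) (T_L T_R : ℝ), ∃ μ : Measure (PhaseSpace N), (0 < T_L → 0 < T_R →
      (pinnedChain ω₂ lam β γ).IsFlipSteadyState N T_L T_R ε μ ∧
        ∀ ν : Measure (PhaseSpace N), (pinnedChain ω₂ lam β γ).IsFlipSteadyState N T_L T_R ε ν → ν = μ) := by
    intro N T_L T_R
    by_cases h : 0 < T_L ∧ 0 < T_R
    · obtain ⟨μ, hμ, hu⟩ := hexu N T_L T_R h.1 h.2
      exact ⟨μ, fun _ _ => ⟨hμ, hu⟩⟩
    · exact ⟨0, fun hL hR => (h ⟨hL, hR⟩).elim⟩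
  choose fam hfam using hex
  obtain ⟨D, hD, hDκ⟩ := hconv fam (fun N T_L T_R hL hR => (hfam N T_L T_R hL hR).1) T hT
  have hκT : 0 < κ T := hκ T hT
  have hev : ∀ᶠ N in atTop, κ T / 2 < D N := hDκ.eventually_const_lt (by linarith)
  obtain ⟨N₀, hN₀⟩ := hev.exists_forall_of_atTop
  refine ⟨κ T / 2, by positivity, N₀, fun N hN με hμε Dε hDε => ?_⟩
  have hsame : Tendsto (fun δ : ℝ => (pinnedChain ω₂ lam β γ).totalCurrent (fam N (T + δ / 2) (T - δ / 2)) / δ)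
      (𝓝[≠] 0) (𝓝 Dε) :=
    (Summit.AtomisticToContinuum.FouriersLaw.Theorems.NoiseLocality.StubResponseContinuousInNoise.tendsto_responseQuotient_iff_flip
      (pinnedChain ω₂ lam β γ) hT ε με (fam N) hμε (fun T_L T_R hL hR => (hfam N T_L T_R hL hR).1) Dε).mp hDε
  have heq : Dε = D N := tendsto_nhds_unique hsame (hD N)
  rw [heq]
  exact (hN₀ N hN).le


/-! ## The Pólya glue (pure real analysis) -/

/-- Closure at `ε = 0⁺` of a bound on `(0, ε]`: if `f` is continuous on `[0,1]` within `[0,1]`, `0 < ε ≤ 1` and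
`f δ ≤ c` for all `δ ∈ (0, ε]`, then `f 0 ≤ c`. [folklore] -/
theorem closure_le {f : ℝ → ℝ} {ε c : ℝ} (hcont : ContinuousOn f (Set.Icc 0 1)) (hε : 0 < ε)
    (h : ∀ δ : ℝ, 0 < δ → δ ≤ ε → f δ ≤ c) : f 0 ≤ c := by
  have h0mem : (0 : ℝ) ∈ Set.Icc (0 : ℝ) 1 := ⟨le_rfl, zero_le_one⟩
  have hl : Tendsto f (𝓝[Set.Icc (0 : ℝ) 1] 0) (𝓝 (f 0)) := hcont 0 h0mem
  have hl' : Tendsto f (𝓝[>] (0 : ℝ)) (𝓝 (f 0)) := by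
    have h' := hl.mono_left (nhdsWithin_mono (0 : ℝ) (Set.Ioc_subset_Icc_self (a := (0 : ℝ)) (b := 1)))
    rwa [nhdsWithin_Ioc_eq_nhdsGT zero_lt_one] at h'
  have hev : ∀ᶠ δ in 𝓝[>] (0 : ℝ), f δ ≤ c := by
    have h1 : ∀ᶠ δ in 𝓝[>] (0 : ℝ), δ ≤ ε := mem_nhdsWithin_of_mem_nhds (Iic_mem_nhds hε)
    have h2 : ∀ᶠ δ in 𝓝[>] (0 : ℝ), 0 < δ := self_mem_nhdsWithin
    filter_upwards [h1, h2] with δ hδ1 hδ2 using h δ hδ2 hδ1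
  exact le_of_tendsto hl' hev

/-- **Pólya-type transfer.** Let `r N : ℝ → ℝ` (`N ≥ 2`) be continuous on `[0,1]` and nonnegative there, with the
scaling `r N ε' ≤ (ε'/ε) r N ε` for `0 < ε ≤ ε' ≤ 1`.  Suppose (S1) for every `η > 0` there are `N_η`, `ε_η ∈ (0,1]`
with `r N ε ≤ r N ε' + η` for `N ≥ N_η`, `0 < ε ≤ ε' ≤ ε_η`; (S2) for every `η > 0` there is `ε_η ∈ (0,1]` such that
for every `ε ∈ (0, ε_η]` eventually in `N`, `r N ε ≤ r N 0 + η`; (F) for every `ε ∈ (0,1]`, `r N ε` is eventually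
(in `N`) bounded.  Then there is ONE modulus `w → 0` at `0⁺` with `|r N ε − r N 0| ≤ w ε` for ALL `N ≥ 2`,
`ε ∈ (0,1]`. [folklore] -/
theorem modulus_of_polya (r : ℕ → ℝ → ℝ)
    (hcont : ∀ N : ℕ, 2 ≤ N → ContinuousOn (r N) (Set.Icc 0 1))
    (hpos : ∀ N : ℕ, 2 ≤ N → ∀ ε : ℝ, 0 ≤ ε → ε ≤ 1 → 0 ≤ r N ε)
    (hscale : ∀ N : ℕ, 2 ≤ N → ∀ ε ε' : ℝ, 0 < ε → ε ≤ ε' → ε' ≤ 1 → r N ε' ≤ ε' / ε * r N ε)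
    (hmono : ∀ η : ℝ, 0 < η → ∃ (Nη : ℕ) (εη : ℝ), 0 < εη ∧ εη ≤ 1 ∧
      ∀ N : ℕ, Nη ≤ N → 2 ≤ N → ∀ ε ε' : ℝ, 0 < ε → ε ≤ ε' → ε' ≤ εη → r N ε ≤ r N ε' + η)
    (hlim : ∀ η : ℝ, 0 < η → ∃ εη : ℝ, 0 < εη ∧ εη ≤ 1 ∧
      ∀ ε : ℝ, 0 < ε → ε ≤ εη → ∃ N₀ : ℕ, ∀ N : ℕ, N₀ ≤ N → 2 ≤ N → r N ε ≤ r N 0 + η)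
    (hfloor : ∀ ε : ℝ, 0 < ε → ε ≤ 1 → ∃ (B : ℝ) (N₀ : ℕ), ∀ N : ℕ, N₀ ≤ N → 2 ≤ N → r N ε ≤ B) :
    ∃ w : ℝ → ℝ, Tendsto w (𝓝[>] 0) (𝓝 0) ∧
      ∀ N : ℕ, 2 ≤ N → ∀ ε : ℝ, 0 < ε → ε ≤ 1 → |r N ε - r N 0| ≤ w ε := by
  -- closure of (S1) at `ε = 0⁺`: the lower half
  have hmono0 : ∀ η : ℝ, 0 < η → ∃ (Nη : ℕ) (εη : ℝ), 0 < εη ∧ εη ≤ 1 ∧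
      ∀ N : ℕ, Nη ≤ N → 2 ≤ N → ∀ ε : ℝ, 0 < ε → ε ≤ εη → r N 0 ≤ r N ε + η := by
    intro η hη
    obtain ⟨Nη, εη, hεη, hεη1, h⟩ := hmono η hη
    refine ⟨Nη, εη, hεη, hεη1, fun N hN hN2 ε hε hεη' => ?_⟩
    exact closure_le (hcont N hN2) hε fun δ hδ hδε => h N hN hN2 δ ε hδ hδε hεη'
  -- Step A: a uniform bound on the tail
  obtain ⟨N₁, ε₁, hε₁, hε₁1, h1⟩ := hmono 1 one_pos
  obtain ⟨N₁', ε₁', hε₁', hε₁'1, h1'⟩ := hmono0 1 one_pos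
  set e : ℝ := min ε₁ ε₁' with he
  have he0 : 0 < e := lt_min hε₁ hε₁'
  have he1 : e ≤ 1 := (min_le_left _ _).trans hε₁1
  obtain ⟨B, N₂, hB⟩ := hfloor e he0 he1
  set M : ℕ := max (max (max N₁ N₁') N₂) 2 with hM
  have hM2 : 2 ≤ M := le_max_right _ _
  have hMN₁ : N₁ ≤ M := ((le_max_left _ _).trans (le_max_left _ _)).trans (le_max_left _ _)
  have hMN₁' : N₁' ≤ M := ((le_max_right _ _).trans (le_max_left _ _)).trans (le_max_left _ _)
  have hMN₂ : N₂ ≤ M := (le_max_right _ _).trans (le_max_left _ _)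
  have hBe : ∀ N : ℕ, M ≤ N → r N e ≤ B := fun N hN => hB N (hMN₂.trans hN) (hM2.trans hN)
  have hB0 : 0 ≤ B := (hpos M hM2 e he0.le he1).trans (hBe M le_rfl)
  set K : ℝ := max (B + 1) (B / e) with hK
  have tail : ∀ N : ℕ, M ≤ N → ∀ ε : ℝ, 0 ≤ ε → ε ≤ 1 → r N ε ≤ K := by
    intro N hN ε hε0 hε1
    have hN2 : 2 ≤ N := hM2.trans hN
    rcases hε0.eq_or_lt with h | h
    · -- `ε = 0`
      subst h
      have := h1' N (hMN₁'.trans hN) hN2 e he0 (min_le_right _ _)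
      calc r N 0 ≤ r N e + 1 := this
        _ ≤ B + 1 := by linarith [hBe N hN]
        _ ≤ K := le_max_left _ _
    · rcases le_or_gt ε e with h' | h'
      · have := h1 N (hMN₁.trans hN) hN2 ε e h h' (min_le_left _ _)
        calc r N ε ≤ r N e + 1 := this
          _ ≤ B + 1 := by linarith [hBe N hN]
          _ ≤ K := le_max_left _ _
      · have hs := hscale N hN2 e ε he0 h'.le hε1
        calc r N ε ≤ ε / e * r N e := hs
          _ ≤ 1 / e * B := by
              apply mul_le_mul _ (hBe N hN) (hpos N hN2 e he0.le he1) (by positivity)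
              exact div_le_div_of_nonneg_right hε1 he0.le
          _ = B / e := by ring
          _ ≤ K := le_max_right _ _
  have hK0 : 0 ≤ K := (hpos M hM2 0 le_rfl zero_le_one).trans (tail M le_rfl 0 le_rfl zero_le_one)
  -- the discrepancy table, indexed from `N = 2`
  set g : ℝ → ℕ → ℝ := fun ε n => |r (n + 2) ε - r (n + 2) 0| with hg
  have g_nonneg : ∀ ε n, 0 ≤ g ε n := fun ε n => abs_nonneg _
  have g_tail_le : ∀ ε : ℝ, 0 < ε → ε ≤ 1 → ∀ n, M ≤ n + 2 → g ε n ≤ K := by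
    intro ε hε hε1 n hn
    have a := tail (n + 2) hn ε hε.le hε1
    have b := tail (n + 2) hn 0 le_rfl zero_le_one
    have c := hpos (n + 2) (by omega) ε hε.le hε1
    have d := hpos (n + 2) (by omega) 0 le_rfl zero_le_one
    simp only [hg]
    rw [abs_le]
    constructor <;> linarith
  have hbdd : ∀ ε : ℝ, 0 < ε → ε ≤ 1 → BddAbove (Set.range (g ε)) := by
    intro ε hε hε1
    have hfin : BddAbove ((g ε) '' Set.Iio M) := ((Set.finite_Iio M).image _).bddAbove
    have htail : BddAbove ((g ε) '' Set.Ici M) :=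
      ⟨K, by
        rintro _ ⟨n, hn, rfl⟩
        exact g_tail_le ε hε hε1 n (le_trans hn (Nat.le_add_right n 2))⟩
    refine (hfin.union htail).mono ?_
    rintro _ ⟨n, rfl⟩
    rcases lt_or_ge n M with hn | hn
    · exact Or.inl ⟨n, hn, rfl⟩
    · exact Or.inr ⟨n, hn, rfl⟩
  refine ⟨fun ε => ⨆ n, g ε n, ?_, ?_⟩
  · -- Step B: the modulus tends to `0`
    refine Metric.tendsto_nhds.mpr fun η hη => ?_
    have hη4 : 0 < η / 4 := by positivity
    obtain ⟨Na, εa, hεa, hεa1, ha⟩ := hmono (η / 4) hη4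
    obtain ⟨Na', εa', hεa', hεa'1, ha'⟩ := hmono0 (η / 4) hη4
    obtain ⟨εb, hεb, hεb1, hb⟩ := hlim (η / 4) hη4
    set e'' : ℝ := min (min εa εa') εb with he''
    have he''0 : 0 < e'' := lt_min (lt_min hεa hεa') hεb
    have he''a : e'' ≤ εa := (min_le_left _ _).trans (min_le_left _ _)
    have he''a' : e'' ≤ εa' := (min_le_left _ _).trans (min_le_right _ _)
    have he''b : e'' ≤ εb := min_le_right _ _
    obtain ⟨Nb, hNb⟩ := hb e'' he''0 he''b
    set N'' : ℕ := max (max Na Na') Nb with hN''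
    -- the tail `n + 2 ≥ N''`, for `ε ≤ e''`
    have htail : ∀ ε : ℝ, 0 < ε → ε ≤ e'' → ∀ n : ℕ, N'' ≤ n + 2 → g ε n ≤ η / 2 := by
      intro ε hε hεe n hn
      have hn2 : 2 ≤ n + 2 := by omega
      have hNa : Na ≤ n + 2 := ((le_max_left _ _).trans (le_max_left _ _)).trans hn
      have hNa' : Na' ≤ n + 2 := ((le_max_right _ _).trans (le_max_left _ _)).trans hn
      have hNb' : Nb ≤ n + 2 := (le_max_right _ _).trans hn
      have up1 : r (n + 2) ε ≤ r (n + 2) e'' + η / 4 := ha (n + 2) hNa hn2 ε e'' hε hεe he''a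
      have up2 : r (n + 2) e'' ≤ r (n + 2) 0 + η / 4 := hNb (n + 2) hNb' hn2
      have lo : r (n + 2) 0 ≤ r (n + 2) ε + η / 4 := ha' (n + 2) hNa' hn2 ε hε (hεe.trans he''a')
      simp only [hg]
      rw [abs_le]
      constructor <;> linarith
    -- the finitely many `n + 2 < N''`: fixed-`N` continuity at `0`
    have hfin : ∀ᶠ ε in 𝓝[>] (0 : ℝ), ∀ n ∈ Finset.range N'', g ε n < η / 2 := by
      refine (eventually_all_finset _).mpr fun n _ => ?_
      have h0mem : (0 : ℝ) ∈ Set.Icc (0 : ℝ) 1 := ⟨le_rfl, zero_le_one⟩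
      have hr : Tendsto (r (n + 2)) (𝓝[>] (0 : ℝ)) (𝓝 (r (n + 2) 0)) := by
        have h' := (hcont (n + 2) (by omega) 0 h0mem).mono_left
          (nhdsWithin_mono (0 : ℝ) (Set.Ioc_subset_Icc_self (a := (0 : ℝ)) (b := 1)))
        rwa [nhdsWithin_Ioc_eq_nhdsGT zero_lt_one] at h'
      have h0 : Tendsto (fun ε => g ε n) (𝓝[>] 0) (𝓝 0) := by
        have := (hr.sub_const (r (n + 2) 0)).abs
        simpa [hg] using this
      have := (Metric.tendsto_nhds.mp h0) (η / 2) (by positivity)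
      simpa only [Real.dist_eq, sub_zero, abs_of_nonneg (g_nonneg _ n)] using this
    have h2ev : ∀ᶠ ε in 𝓝[>] (0 : ℝ), ε ≤ 1 := mem_nhdsWithin_of_mem_nhds (Iic_mem_nhds one_pos)
    have h3ev : ∀ᶠ ε in 𝓝[>] (0 : ℝ), 0 < ε := self_mem_nhdsWithin
    have h4ev : ∀ᶠ ε in 𝓝[>] (0 : ℝ), ε ≤ e'' := mem_nhdsWithin_of_mem_nhds (Iic_mem_nhds he''0)
    filter_upwards [hfin, h2ev, h3ev, h4ev] with ε hfε hε1 hε hεe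
    have hall : ∀ n, g ε n ≤ η / 2 := by
      intro n
      rcases lt_or_ge (n + 2) N'' with hn | hn
      · exact (hfε n (Finset.mem_range.mpr (by omega))).le
      · exact htail ε hε hεe n hn
    have hsup : (⨆ n, g ε n) ≤ η / 2 := ciSup_le hall
    have hsup0 : 0 ≤ ⨆ n, g ε n := le_ciSup_of_le (hbdd ε hε hε1) 0 (g_nonneg ε 0)
    rw [Real.dist_eq, sub_zero, abs_of_nonneg hsup0]
    linarith
  · -- the bound itself
    intro N hN ε hε hε1
    obtain ⟨n, rfl⟩ : ∃ n, N = n + 2 := ⟨N - 2, by omega⟩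
    exact le_ciSup (hbdd ε hε hε1) n


/-! ## Composition: (S1) ∧ (S2) ∧ (F) ⟹ the crux -/

/-- **`noiseLocality_of_polya`.** The registered texts of `stub_smallNoiseQuasiMonotone` (S1), `stub_noResidualResistivity` (S2) and
`stub_noisyConductanceFloor` (F) of line `polya-noise-monotone`, verbatim as hypotheses, imply `VanishingNoiseTransfer.NoiseLocality`:
canonical responses (`MonotoneReduction.canonical_of_three`); S1/S2/F and `noise_scaling` at the canonical families give the
hypotheses of `modulus_of_polya` for `r N ε := (Dc N ε)⁻¹`; the crux's own `μ0, με, D0, Dε` are identified with the canonical ones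
by uniqueness of limits along `𝓝[≠] 0` (`N ≥ 2`, weighted form), and `N ≤ 1` is currentless. CONDITIONAL. [folklore] -/
theorem noiseLocality_of_polya
    (hS1 :
    ∀ ω₂ lam β γ : ℝ, 0 < ω₂ → 0 < lam → 0 < β → 0 < γ → ∀ T : ℝ, 0 < T → ∀ η : ℝ, 0 < η →
    ∃ (Nη : ℕ) (εη : ℝ), 0 < εη ∧ εη ≤ 1 ∧ ∀ (N : ℕ), Nη ≤ N → 2 ≤ N →
    ∀ ε ε' : ℝ, 0 < ε → ε ≤ ε' → ε' ≤ εη →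
    ∀ μ : ℝ → ℝ →
        MeasureTheory.Measure (Literature.MathematicalPhysics.KineticTheory.HeatConduction.PhaseSpace N),
      (∀ T_L T_R : ℝ, 0 < T_L → 0 < T_R →
        (Literature.MathematicalPhysics.KineticTheory.HeatConduction.pinnedChain ω₂ lam β γ).IsFlipSteadyState
            N T_L T_R ε (μ T_L T_R) ∧
          ∀ ν : MeasureTheory.Measure (Literature.MathematicalPhysics.KineticTheory.HeatConduction.PhaseSpace N),
            (Literature.MathematicalPhysics.KineticTheory.HeatConduction.pinnedChain ω₂ lam β γ).IsFlipSteadyState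
              N T_L T_R ε ν → ν = μ T_L T_R) →
    ∀ μ' : ℝ → ℝ →
        MeasureTheory.Measure (Literature.MathematicalPhysics.KineticTheory.HeatConduction.PhaseSpace N),
      (∀ T_L T_R : ℝ, 0 < T_L → 0 < T_R →
        (Literature.MathematicalPhysics.KineticTheory.HeatConduction.pinnedChain ω₂ lam β γ).IsFlipSteadyState
            N T_L T_R ε' (μ' T_L T_R) ∧
          ∀ ν : MeasureTheory.Measure (Literature.MathematicalPhysics.KineticTheory.HeatConduction.PhaseSpace N),
            (Literature.MathematicalPhysics.KineticTheory.HeatConduction.pinnedChain ω₂ lam β γ).IsFlipSteadyState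
              N T_L T_R ε' ν → ν = μ' T_L T_R) →
    ∀ D D' : ℝ,
      Filter.Tendsto (fun δ : ℝ =>
          (Literature.MathematicalPhysics.KineticTheory.HeatConduction.pinnedChain ω₂ lam β γ).totalCurrent
            (μ (T + δ / 2) (T - δ / 2)) / δ) (nhdsWithin 0 {(0 : ℝ)}ᶜ) (nhds D) →
      Filter.Tendsto (fun δ : ℝ =>
          (Literature.MathematicalPhysics.KineticTheory.HeatConduction.pinnedChain ω₂ lam β γ).totalCurrent
            (μ' (T + δ / 2) (T - δ / 2)) / δ) (nhdsWithin 0 {(0 : ℝ)}ᶜ) (nhds D') →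
      D⁻¹ ≤ D'⁻¹ + η)
    (hS2 :
    ∀ ω₂ lam β γ : ℝ, 0 < ω₂ → 0 < lam → 0 < β → 0 < γ → ∀ T : ℝ, 0 < T → ∀ η : ℝ, 0 < η →
    ∃ εη : ℝ, 0 < εη ∧ εη ≤ 1 ∧ ∀ ε : ℝ, 0 < ε → ε ≤ εη → ∃ N₀ : ℕ, ∀ (N : ℕ), N₀ ≤ N → 2 ≤ N →
    ∀ μ0 : ℝ → ℝ →
        MeasureTheory.Measure (Literature.MathematicalPhysics.KineticTheory.HeatConduction.PhaseSpace N),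
      (∀ T_L T_R : ℝ, 0 < T_L → 0 < T_R →
        (Literature.MathematicalPhysics.KineticTheory.HeatConduction.pinnedChain ω₂ lam β γ).IsSteadyState
            N T_L T_R (μ0 T_L T_R) ∧
          ∀ ν : MeasureTheory.Measure (Literature.MathematicalPhysics.KineticTheory.HeatConduction.PhaseSpace N),
            (Literature.MathematicalPhysics.KineticTheory.HeatConduction.pinnedChain ω₂ lam β γ).IsSteadyState
              N T_L T_R ν → ν = μ0 T_L T_R) →
    ∀ με : ℝ → ℝ →
        MeasureTheory.Measure (Literature.MathematicalPhysics.KineticTheory.HeatConduction.PhaseSpace N),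
      (∀ T_L T_R : ℝ, 0 < T_L → 0 < T_R →
        (Literature.MathematicalPhysics.KineticTheory.HeatConduction.pinnedChain ω₂ lam β γ).IsFlipSteadyState
            N T_L T_R ε (με T_L T_R) ∧
          ∀ ν : MeasureTheory.Measure (Literature.MathematicalPhysics.KineticTheory.HeatConduction.PhaseSpace N),
            (Literature.MathematicalPhysics.KineticTheory.HeatConduction.pinnedChain ω₂ lam β γ).IsFlipSteadyState
              N T_L T_R ε ν → ν = με T_L T_R) →
    ∀ D0 Dε : ℝ,
      Filter.Tendsto (fun δ : ℝ =>
          (Literature.MathematicalPhysics.KineticTheory.HeatConduction.pinnedChain ω₂ lam β γ).totalCurrent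
            (μ0 (T + δ / 2) (T - δ / 2)) / δ) (nhdsWithin 0 {(0 : ℝ)}ᶜ) (nhds D0) →
      Filter.Tendsto (fun δ : ℝ =>
          (Literature.MathematicalPhysics.KineticTheory.HeatConduction.pinnedChain ω₂ lam β γ).totalCurrent
            (με (T + δ / 2) (T - δ / 2)) / δ) (nhdsWithin 0 {(0 : ℝ)}ᶜ) (nhds Dε) →
      Dε⁻¹ ≤ D0⁻¹ + η)
    (hF :
    ∀ ω₂ lam β γ : ℝ, 0 < ω₂ → 0 < lam → 0 < β → 0 < γ → ∀ T : ℝ, 0 < T →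
    ∀ ε : ℝ, 0 < ε → ε ≤ 1 → ∃ d : ℝ, 0 < d ∧ ∃ N₀ : ℕ, ∀ (N : ℕ), N₀ ≤ N →
    ∀ με : ℝ → ℝ →
        MeasureTheory.Measure (Literature.MathematicalPhysics.KineticTheory.HeatConduction.PhaseSpace N),
      (∀ T_L T_R : ℝ, 0 < T_L → 0 < T_R →
        (Literature.MathematicalPhysics.KineticTheory.HeatConduction.pinnedChain ω₂ lam β γ).IsFlipSteadyState
            N T_L T_R ε (με T_L T_R) ∧
          ∀ ν : MeasureTheory.Measure (Literature.MathematicalPhysics.KineticTheory.HeatConduction.PhaseSpace N),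
            (Literature.MathematicalPhysics.KineticTheory.HeatConduction.pinnedChain ω₂ lam β γ).IsFlipSteadyState
              N T_L T_R ε ν → ν = με T_L T_R) →
    ∀ Dε : ℝ,
      Filter.Tendsto (fun δ : ℝ =>
          (Literature.MathematicalPhysics.KineticTheory.HeatConduction.pinnedChain ω₂ lam β γ).totalCurrent
            (με (T + δ / 2) (T - δ / 2)) / δ) (nhdsWithin 0 {(0 : ℝ)}ᶜ) (nhds Dε) →
      d ≤ Dε) :
    Summit.AtomisticToContinuum.FouriersLaw.Theses.VanishingNoiseTransfer.NoiseLocality := by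
  intro ω₂ lam β γ hω hl hβ hγ S hS T hT
  subst hS
  obtain ⟨μc, Dc, hfam, hcont, hpos, hcan⟩ := MonotoneReduction.canonical_of_three hω hl hβ hγ hT
  -- the deterministic canonical family in `IsSteadyState` form
  have hfam0 : ∀ (N : ℕ) (T_L T_R : ℝ), 0 < T_L → 0 < T_R →
      (pinnedChain ω₂ lam β γ).IsSteadyState N T_L T_R (μc N 0 T_L T_R) ∧
        ∀ ν : Measure (PhaseSpace N),
          (pinnedChain ω₂ lam β γ).IsSteadyState N T_L T_R ν → ν = μc N 0 T_L T_R := by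
    intro N T_L T_R hL hR
    obtain ⟨h1, h2⟩ := hfam N 0 le_rfl zero_le_one T_L T_R hL hR
    refine ⟨((pinnedChain ω₂ lam β γ).isFlipSteadyState_zero_iff N T_L T_R _).1 h1, fun ν hν => h2 ν ?_⟩
    exact ((pinnedChain ω₂ lam β γ).isFlipSteadyState_zero_iff N T_L T_R ν).2 hν
  -- the table of resistivities
  set r : ℕ → ℝ → ℝ := fun N ε => (Dc N ε)⁻¹ with hr
  have hcont' : ∀ N : ℕ, 2 ≤ N → ContinuousOn (r N) (Set.Icc 0 1) :=
    fun N hN => (hcont N).inv₀ fun ε hε => (hpos N hN ε hε.1 hε.2).ne'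
  have hpos' : ∀ N : ℕ, 2 ≤ N → ∀ ε : ℝ, 0 ≤ ε → ε ≤ 1 → 0 ≤ r N ε := fun N hN ε hε0 hε1 => by
    simp only [hr]
    exact (inv_pos.2 (hpos N hN ε hε0 hε1)).le
  -- scaling (free)
  have hscale : ∀ N : ℕ, 2 ≤ N → ∀ ε ε' : ℝ, 0 < ε → ε ≤ ε' → ε' ≤ 1 → r N ε' ≤ ε' / ε * r N ε := by
    intro N hN ε ε' hε hεε' hε'1
    have hε' : 0 < ε' := hε.trans_le hεε'
    have h := noise_scaling hω hl hβ hγ hT N hε hεε' hε'1 (μc N ε) (μc N ε') (hfam N ε hε.le (hεε'.trans hε'1))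
      (hfam N ε' hε'.le hε'1) (hcan N ε hε.le (hεε'.trans hε'1) (μc N ε) (hfam N ε hε.le (hεε'.trans hε'1)))
      (hcan N ε' hε'.le hε'1 (μc N ε') (hfam N ε' hε'.le hε'1))
    have hD : 0 < Dc N ε := hpos N hN ε hε.le (hεε'.trans hε'1)
    have hD' : 0 < Dc N ε' := hpos N hN ε' hε'.le hε'1
    have hεne : ε ≠ 0 := hε.ne'
    have hε'ne : ε' ≠ 0 := hε'.ne'
    have hDne : Dc N ε ≠ 0 := hD.ne'
    have h' : ε / ε' * Dc N ε ≤ Dc N ε' := by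
      rw [div_mul_eq_mul_div, div_le_iff₀ hε']
      calc ε * Dc N ε ≤ ε' * Dc N ε' := h
        _ = Dc N ε' * ε' := mul_comm _ _
    have hpos'' : 0 < ε / ε' * Dc N ε := by positivity
    simp only [hr]
    calc (Dc N ε')⁻¹ ≤ (ε / ε' * Dc N ε)⁻¹ := inv_anti₀ hpos'' h'
      _ = ε' / ε * (Dc N ε)⁻¹ := by field_simp
  -- S1 at the canonical families
  have hmono : ∀ η : ℝ, 0 < η → ∃ (Nη : ℕ) (εη : ℝ), 0 < εη ∧ εη ≤ 1 ∧
      ∀ N : ℕ, Nη ≤ N → 2 ≤ N → ∀ ε ε' : ℝ, 0 < ε → ε ≤ ε' → ε' ≤ εη → r N ε ≤ r N ε' + η := by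
    intro η hη
    obtain ⟨Nη, εη, hεη, hεη1, h⟩ := hS1 ω₂ lam β γ hω hl hβ hγ T hT η hη
    refine ⟨Nη, εη, hεη, hεη1, fun N hN hN2 ε ε' hε hεε' hε'η => ?_⟩
    have hε' : 0 < ε' := hε.trans_le hεε'
    have hε1 : ε ≤ 1 := hεε'.trans (hε'η.trans hεη1)
    have hε'1 : ε' ≤ 1 := hε'η.trans hεη1
    have := h N hN hN2 ε ε' hε hεε' hε'η (μc N ε) (hfam N ε hε.le hε1) (μc N ε') (hfam N ε' hε'.le hε'1)
      (Dc N ε) (Dc N ε') (hcan N ε hε.le hε1 (μc N ε) (hfam N ε hε.le hε1))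
      (hcan N ε' hε'.le hε'1 (μc N ε') (hfam N ε' hε'.le hε'1))
    simpa only [hr] using this
  -- S2 at the canonical families
  have hlim : ∀ η : ℝ, 0 < η → ∃ εη : ℝ, 0 < εη ∧ εη ≤ 1 ∧
      ∀ ε : ℝ, 0 < ε → ε ≤ εη → ∃ N₀ : ℕ, ∀ N : ℕ, N₀ ≤ N → 2 ≤ N → r N ε ≤ r N 0 + η := by
    intro η hη
    obtain ⟨εη, hεη, hεη1, h⟩ := hS2 ω₂ lam β γ hω hl hβ hγ T hT η hη
    refine ⟨εη, hεη, hεη1, fun ε hε hεη' => ?_⟩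
    obtain ⟨N₀, hN₀⟩ := h ε hε hεη'
    refine ⟨N₀, fun N hN hN2 => ?_⟩
    have hε1 : ε ≤ 1 := hεη'.trans hεη1
    have := hN₀ N hN hN2 (μc N 0) (hfam0 N) (μc N ε) (hfam N ε hε.le hε1) (Dc N 0) (Dc N ε)
      (hcan N 0 le_rfl zero_le_one (μc N 0) (hfam N 0 le_rfl zero_le_one))
      (hcan N ε hε.le hε1 (μc N ε) (hfam N ε hε.le hε1))
    simpa only [hr] using this
  -- F at the canonical families
  have hfloor : ∀ ε : ℝ, 0 < ε → ε ≤ 1 → ∃ (B : ℝ) (N₀ : ℕ), ∀ N : ℕ, N₀ ≤ N → 2 ≤ N → r N ε ≤ B := by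
    intro ε hε hε1
    obtain ⟨d, hd, N₀, h⟩ := hF ω₂ lam β γ hω hl hβ hγ T hT ε hε hε1
    refine ⟨d⁻¹, N₀, fun N hN hN2 => ?_⟩
    have := h N hN (μc N ε) (hfam N ε hε.le hε1) (Dc N ε) (hcan N ε hε.le hε1 (μc N ε) (hfam N ε hε.le hε1))
    simp only [hr]
    exact inv_anti₀ hd this
  obtain ⟨w, hw, hwb⟩ := modulus_of_polya r hcont' hpos' hscale hmono hlim hfloor
  -- the crux for its own `μ0, με, D0, Dε`
  refine ⟨w, hw, ?_⟩
  intro N ε hε hε1 μ0 με hμ0 hμε D0 Dε hD0 hDε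
  by_cases hN : 2 ≤ N
  · have hμ0' : ∀ T_L T_R : ℝ, 0 < T_L → 0 < T_R →
        (pinnedChain ω₂ lam β γ).IsFlipSteadyState N T_L T_R 0 (μ0 T_L T_R) ∧
          ∀ ν : Measure (PhaseSpace N),
            (pinnedChain ω₂ lam β γ).IsFlipSteadyState N T_L T_R 0 ν → ν = μ0 T_L T_R := by
      intro T_L T_R hL hR
      refine ⟨((pinnedChain ω₂ lam β γ).isFlipSteadyState_zero_iff N T_L T_R _).2 (hμ0 T_L T_R hL hR).1,
        fun ν hν => (hμ0 T_L T_R hL hR).2 ν ?_⟩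
      exact ((pinnedChain ω₂ lam β γ).isFlipSteadyState_zero_iff N T_L T_R ν).1 hν
    have hD0eq : D0 = Dc N 0 := tendsto_nhds_unique hD0 (hcan N 0 le_rfl zero_le_one μ0 hμ0')
    have hDεeq : Dε = Dc N ε := tendsto_nhds_unique hDε (hcan N ε hε.le hε1 με hμε)
    have hD0pos : 0 < D0 := hD0eq ▸ hpos N hN 0 le_rfl zero_le_one
    have hDεpos : 0 < Dε := hDεeq ▸ hpos N hN ε hε.le hε1
    have hb : |Dε⁻¹ - D0⁻¹| ≤ w ε := by
      rw [hD0eq, hDεeq]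
      exact hwb N hN ε hε hε1
    have key : D0 - Dε = D0 * Dε * (Dε⁻¹ - D0⁻¹) := by
      rw [mul_sub, mul_assoc, mul_inv_cancel₀ hDεpos.ne', mul_one, mul_comm D0 Dε, mul_assoc,
        mul_inv_cancel₀ hD0pos.ne', mul_one]
    rw [key, abs_mul, abs_mul]
    calc |D0| * |Dε| * |Dε⁻¹ - D0⁻¹| ≤ |D0| * |Dε| * w ε := by gcongr
      _ = w ε * |D0| * |Dε| := by ring
  · -- `N ≤ 1`: no bond, no current, `D0 = Dε = 0`
    have hN1 : N ≤ 1 := by omega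
    have h0 : D0 = 0 :=
      Summit.AtomisticToContinuum.FouriersLaw.Theorems.NoiseLocality.FeketeReduction.response_eq_zero_of_le_one _ hN1 μ0 T D0 hD0
    have hε0 : Dε = 0 :=
      Summit.AtomisticToContinuum.FouriersLaw.Theorems.NoiseLocality.FeketeReduction.response_eq_zero_of_le_one _ hN1 με T Dε hDε
    simp [h0, hε0]


/-- **Within the route's own cone:** (S1) ∧ (S2) ∧ `NoisyFourier` ⟹ `NoiseLocality` — the floor (F) is supplied by the route's
rank-4 crux `NoisyFourier` (`noisyFloor_of_noisyFourier`), so relative to the route the Pólya line adds exactly the two stubs S1, S2.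
CONDITIONAL. [folklore] -/
theorem noiseLocality_of_polya_noisyFourier
    (hS1 :
    ∀ ω₂ lam β γ : ℝ, 0 < ω₂ → 0 < lam → 0 < β → 0 < γ → ∀ T : ℝ, 0 < T → ∀ η : ℝ, 0 < η →
    ∃ (Nη : ℕ) (εη : ℝ), 0 < εη ∧ εη ≤ 1 ∧ ∀ (N : ℕ), Nη ≤ N → 2 ≤ N →
    ∀ ε ε' : ℝ, 0 < ε → ε ≤ ε' → ε' ≤ εη →
    ∀ μ : ℝ → ℝ →
        MeasureTheory.Measure (Literature.MathematicalPhysics.KineticTheory.HeatConduction.PhaseSpace N),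
      (∀ T_L T_R : ℝ, 0 < T_L → 0 < T_R →
        (Literature.MathematicalPhysics.KineticTheory.HeatConduction.pinnedChain ω₂ lam β γ).IsFlipSteadyState
            N T_L T_R ε (μ T_L T_R) ∧
          ∀ ν : MeasureTheory.Measure (Literature.MathematicalPhysics.KineticTheory.HeatConduction.PhaseSpace N),
            (Literature.MathematicalPhysics.KineticTheory.HeatConduction.pinnedChain ω₂ lam β γ).IsFlipSteadyState
              N T_L T_R ε ν → ν = μ T_L T_R) →
    ∀ μ' : ℝ → ℝ →
        MeasureTheory.Measure (Literature.MathematicalPhysics.KineticTheory.HeatConduction.PhaseSpace N),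
      (∀ T_L T_R : ℝ, 0 < T_L → 0 < T_R →
        (Literature.MathematicalPhysics.KineticTheory.HeatConduction.pinnedChain ω₂ lam β γ).IsFlipSteadyState
            N T_L T_R ε' (μ' T_L T_R) ∧
          ∀ ν : MeasureTheory.Measure (Literature.MathematicalPhysics.KineticTheory.HeatConduction.PhaseSpace N),
            (Literature.MathematicalPhysics.KineticTheory.HeatConduction.pinnedChain ω₂ lam β γ).IsFlipSteadyState
              N T_L T_R ε' ν → ν = μ' T_L T_R) →
    ∀ D D' : ℝ,
      Filter.Tendsto (fun δ : ℝ =>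
          (Literature.MathematicalPhysics.KineticTheory.HeatConduction.pinnedChain ω₂ lam β γ).totalCurrent
            (μ (T + δ / 2) (T - δ / 2)) / δ) (nhdsWithin 0 {(0 : ℝ)}ᶜ) (nhds D) →
      Filter.Tendsto (fun δ : ℝ =>
          (Literature.MathematicalPhysics.KineticTheory.HeatConduction.pinnedChain ω₂ lam β γ).totalCurrent
            (μ' (T + δ / 2) (T - δ / 2)) / δ) (nhdsWithin 0 {(0 : ℝ)}ᶜ) (nhds D') →
      D⁻¹ ≤ D'⁻¹ + η)
    (hS2 :
    ∀ ω₂ lam β γ : ℝ, 0 < ω₂ → 0 < lam → 0 < β → 0 < γ → ∀ T : ℝ, 0 < T → ∀ η : ℝ, 0 < η →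
    ∃ εη : ℝ, 0 < εη ∧ εη ≤ 1 ∧ ∀ ε : ℝ, 0 < ε → ε ≤ εη → ∃ N₀ : ℕ, ∀ (N : ℕ), N₀ ≤ N → 2 ≤ N →
    ∀ μ0 : ℝ → ℝ →
        MeasureTheory.Measure (Literature.MathematicalPhysics.KineticTheory.HeatConduction.PhaseSpace N),
      (∀ T_L T_R : ℝ, 0 < T_L → 0 < T_R →
        (Literature.MathematicalPhysics.KineticTheory.HeatConduction.pinnedChain ω₂ lam β γ).IsSteadyState
            N T_L T_R (μ0 T_L T_R) ∧
          ∀ ν : MeasureTheory.Measure (Literature.MathematicalPhysics.KineticTheory.HeatConduction.PhaseSpace N),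
            (Literature.MathematicalPhysics.KineticTheory.HeatConduction.pinnedChain ω₂ lam β γ).IsSteadyState
              N T_L T_R ν → ν = μ0 T_L T_R) →
    ∀ με : ℝ → ℝ →
        MeasureTheory.Measure (Literature.MathematicalPhysics.KineticTheory.HeatConduction.PhaseSpace N),
      (∀ T_L T_R : ℝ, 0 < T_L → 0 < T_R →
        (Literature.MathematicalPhysics.KineticTheory.HeatConduction.pinnedChain ω₂ lam β γ).IsFlipSteadyState
            N T_L T_R ε (με T_L T_R) ∧
          ∀ ν : MeasureTheory.Measure (Literature.MathematicalPhysics.KineticTheory.HeatConduction.PhaseSpace N),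
            (Literature.MathematicalPhysics.KineticTheory.HeatConduction.pinnedChain ω₂ lam β γ).IsFlipSteadyState
              N T_L T_R ε ν → ν = με T_L T_R) →
    ∀ D0 Dε : ℝ,
      Filter.Tendsto (fun δ : ℝ =>
          (Literature.MathematicalPhysics.KineticTheory.HeatConduction.pinnedChain ω₂ lam β γ).totalCurrent
            (μ0 (T + δ / 2) (T - δ / 2)) / δ) (nhdsWithin 0 {(0 : ℝ)}ᶜ) (nhds D0) →
      Filter.Tendsto (fun δ : ℝ =>
          (Literature.MathematicalPhysics.KineticTheory.HeatConduction.pinnedChain ω₂ lam β γ).totalCurrent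
            (με (T + δ / 2) (T - δ / 2)) / δ) (nhdsWithin 0 {(0 : ℝ)}ᶜ) (nhds Dε) →
      Dε⁻¹ ≤ D0⁻¹ + η)
    (hNF : Summit.AtomisticToContinuum.FouriersLaw.Theses.VanishingNoiseTransfer.NoisyFourier) :
    Summit.AtomisticToContinuum.FouriersLaw.Theses.VanishingNoiseTransfer.NoiseLocality :=
  noiseLocality_of_polya hS1 hS2 (noisyFloor_of_noisyFourier hNF)

/-- Registered helper sub-goal `helper_noiseLocalityOfPolya` of crux stmt-AtomisticToContinuum-11975 (line `polya-noise-monotone`,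
crux-strategist s2): the three stub texts (S1) (S2) (F), as hypotheses, give the crux — `noiseLocality_of_polya` in registry form.
CONDITIONAL. [folklore] -/
theorem helper_noiseLocalityOfPolya : (∀ ω₂ lam β γ : ℝ, 0 < ω₂ → 0 < lam → 0 < β → 0 < γ → ∀ T : ℝ, 0 < T → ∀ η : ℝ, 0 < η → ∃ (Nη : ℕ) (εη : ℝ), 0 < εη ∧ εη ≤ 1 ∧ ∀ (N : ℕ), Nη ≤ N → 2 ≤ N → ∀ ε ε' : ℝ, 0 < ε → ε ≤ ε' → ε' ≤ εη → ∀ μ : ℝ → ℝ → MeasureTheory.Measure (Literature.MathematicalPhysics.KineticTheory.HeatConduction.PhaseSpace N), (∀ T_L T_R : ℝ, 0 < T_L → 0 < T_R → (Literature.MathematicalPhysics.KineticTheory.HeatConduction.pinnedChain ω₂ lam β γ).IsFlipSteadyState N T_L T_R ε (μ T_L T_R) ∧ ∀ ν : MeasureTheory.Measure (Literature.MathematicalPhysics.KineticTheory.HeatConduction.PhaseSpace N), (Literature.MathematicalPhysics.KineticTheory.HeatConduction.pinnedChain ω₂ lam β γ).IsFlipSteadyState N T_L T_R ε ν → ν =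 μ T_L T_R) → ∀ μ' : ℝ → ℝ → MeasureTheory.Measure (Literature.MathematicalPhysics.KineticTheory.HeatConduction.PhaseSpace N), (∀ T_L T_R : ℝ, 0 < T_L → 0 < T_R → (Literature.MathematicalPhysics.KineticTheory.HeatConduction.pinnedChain ω₂ lam β γ).IsFlipSteadyState N T_L T_R ε' (μ' T_L T_R) ∧ ∀ ν : MeasureTheory.Measure (Literature.MathematicalPhysics.KineticTheory.HeatConduction.PhaseSpace N), (Literature.MathematicalPhysics.KineticTheory.HeatConduction.pinnedChain ω₂ lam β γ).IsFlipSteadyState N T_L T_R ε' ν → ν = μ' T_L T_R) → ∀ D D' : ℝ, Filter.Tendsto (fun δ : ℝ => (Literature.MathematicalPhysics.KineticTheory.HeatConduction.pinnedChain ω₂ lam β γ).totalCurrent (μ (T + δ / 2) (T - δ / 2)) / δ) (nhdsWithin 0 {(0 : ℝ)}ᶜ) (nhds D) → Filter.Tendsto (fun δ : ℝ => (Literature.MathematicalPhysics.KineticTheory.HeatConduction.pinnedChain ω₂ lam β γ).totalCurrent (μ' (T + δ / 2) (T - δ / 2)) / δ) (nhdsWithin 0 {(0 : ℝ)}ᶜ)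 (nhds D') → D⁻¹ ≤ D'⁻¹ + η) → (∀ ω₂ lam β γ : ℝ, 0 < ω₂ → 0 < lam → 0 < β → 0 < γ → ∀ T : ℝ, 0 < T → ∀ η : ℝ, 0 < η → ∃ εη : ℝ, 0 < εη ∧ εη ≤ 1 ∧ ∀ ε : ℝ, 0 < ε → ε ≤ εη → ∃ N₀ : ℕ, ∀ (N : ℕ), N₀ ≤ N → 2 ≤ N → ∀ μ0 : ℝ → ℝ → MeasureTheory.Measure (Literature.MathematicalPhysics.KineticTheory.HeatConduction.PhaseSpace N), (∀ T_L T_R : ℝ, 0 < T_L → 0 < T_R → (Literature.MathematicalPhysics.KineticTheory.HeatConduction.pinnedChain ω₂ lam β γ).IsSteadyState N T_L T_R (μ0 T_L T_R) ∧ ∀ ν : MeasureTheory.Measure (Literature.MathematicalPhysics.KineticTheory.HeatConduction.PhaseSpace N), (Literature.MathematicalPhysics.KineticTheory.HeatConduction.pinnedChain ω₂ lam β γ).IsSteadyState N T_L T_R ν → ν = μ0 T_L T_R) → ∀ με : ℝ → ℝ → MeasureTheory.Measure (Literature.MathematicalPhysics.KineticTheory.HeatConduction.PhaseSpace N), (∀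 T_L T_R : ℝ, 0 < T_L → 0 < T_R → (Literature.MathematicalPhysics.KineticTheory.HeatConduction.pinnedChain ω₂ lam β γ).IsFlipSteadyState N T_L T_R ε (με T_L T_R) ∧ ∀ ν : MeasureTheory.Measure (Literature.MathematicalPhysics.KineticTheory.HeatConduction.PhaseSpace N), (Literature.MathematicalPhysics.KineticTheory.HeatConduction.pinnedChain ω₂ lam β γ).IsFlipSteadyState N T_L T_R ε ν → ν = με T_L T_R) → ∀ D0 Dε : ℝ, Filter.Tendsto (fun δ : ℝ => (Literature.MathematicalPhysics.KineticTheory.HeatConduction.pinnedChain ω₂ lam β γ).totalCurrent (μ0 (T + δ / 2) (T - δ / 2)) / δ) (nhdsWithin 0 {(0 : ℝ)}ᶜ) (nhds D0) → Filter.Tendsto (fun δ : ℝ => (Literature.MathematicalPhysics.KineticTheory.HeatConduction.pinnedChain ω₂ lam β γ).totalCurrent (με (T + δ / 2) (T - δ / 2)) / δ) (nhdsWithin 0 {(0 : ℝ)}ᶜ) (nhds Dε) → Dε⁻¹ ≤ D0⁻¹ + η) → (∀ ω₂ lam β γ : ℝ, 0 < ω₂ → 0 < lam → 0 < β → 0 <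 γ → ∀ T : ℝ, 0 < T → ∀ ε : ℝ, 0 < ε → ε ≤ 1 → ∃ d : ℝ, 0 < d ∧ ∃ N₀ : ℕ, ∀ (N : ℕ), N₀ ≤ N → ∀ με : ℝ → ℝ → MeasureTheory.Measure (Literature.MathematicalPhysics.KineticTheory.HeatConduction.PhaseSpace N), (∀ T_L T_R : ℝ, 0 < T_L → 0 < T_R → (Literature.MathematicalPhysics.KineticTheory.HeatConduction.pinnedChain ω₂ lam β γ).IsFlipSteadyState N T_L T_R ε (με T_L T_R) ∧ ∀ ν : MeasureTheory.Measure (Literature.MathematicalPhysics.KineticTheory.HeatConduction.PhaseSpace N), (Literature.MathematicalPhysics.KineticTheory.HeatConduction.pinnedChain ω₂ lam β γ).IsFlipSteadyState N T_L T_R ε ν → ν = με T_L T_R) → ∀ Dε : ℝ, Filter.Tendsto (fun δ : ℝ => (Literature.MathematicalPhysics.KineticTheory.HeatConduction.pinnedChain ω₂ lam β γ).totalCurrent (με (T + δ / 2) (T - δ / 2)) / δ) (nhdsWithin 0 {(0 : ℝ)}ᶜ) (nhds Dε) → d ≤ Dε) → Summit.AtomisticToContinuum.FouriersLaw.Theses.VanishingNoiseTransfer.NoiseLocality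 :=
  fun hS1 hS2 hF => noiseLocality_of_polya hS1 hS2 hF

end Summit.AtomisticToContinuum.FouriersLaw.Theorems.NoiseLocality.PolyaReduction

end
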